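import Literature.NumberTheory.LFunctions.LFDSingleGramFin
import Literature.NumberTheory.LFunctions.LFDSingleRowSum
import Literature.NumberTheory.LFunctions.LFDSingleGramArith
import Literature.NumberTheory.Sieve.GrahamWeightsDirichletBound
import Literature.NumberTheory.Sieve.DivisorBound
import Literature.NumberTheory.Sieve.GoldbachSingularSeriesSum
import Literature.NumberTheory.LFunctions.GranvilleMollinLinnikRanges
import HarnessLib

/-!
# Log-free zero density for one character, VIII: the duality and the theorem

Topic `Literature/NumberTheory/LFunctions`, sub-namespace `LFDSingle`. Everything here is PROVED.
We assemble parts I–VII into a LOG-FREE ZERO-DENSITY ESTIMATE FOR A SINGLE PRIMITIVE CHARACTER in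
the `q`-aspect at low height (Heath-Brown's Lemma 11.1, PLMS 64 (1992), for one character, by
Graham's weights and the duality principle; the novelty relative to Heath-Brown's setting — where
different characters give pole-free Gram entries — is the scale-averaged weight of part IV, which
makes the Schur bound of the Gram matrix log-free):

  `Σ_{ρ ∈ Z} m(ρ) ≤ K e^{3λ}`

for every finite set `Z` of zeros `ρ = β + iγ` of `L(s, χ)` with `β ≥ 1 − λ/log q`,
`|γ| ≤ q^{1/1000}`, `0 ≤ λ ≤ (log q)/1000`, `q ≥ q₀` (`logFreeDensity_single`).

The duality step is isolated as the abstract `sum_weights_le_of_duality`: if `D_i = Σ_n a_i(n) b_n`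
has `|D_i| ≥ 1/2`, `Σ b_n² ≤ B`, and the Gram matrix `G_{ij} = Σ_n a_i(n) \overline{a_j(n)}` has row
and column sums `≤ R₁`, then `Σ_i m_i ≤ 4 B R₁ max m_i` for any weights `0 ≤ m_i`.

## References
* D. R. Heath-Brown, PLMS 64 (1992), §11, Lemma 11.1. [cite: HeathBrown1992PLMS, §11 Lemma 11.1]
* S. W. Graham, J. Number Theory 10 (1978) 83–94. [folklore]
-/

noncomputable section

open Finset Real Complex
open Literature.NumberTheory.Sieve Literature.NumberTheory.Sieve.GrahamWeights
open Literature.NumberTheory.LFunctions.DirichletDisc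

namespace Literature.NumberTheory.LFunctions.LFDSingle

/-! ### The abstract duality inequality -/

/-- `z \overline{z} = ‖z‖²` as a complex number. [folklore] -/
theorem mul_conj_eq_norm_sq (z : ℂ) : z * (starRingEnd ℂ) z = ((‖z‖ ^ 2 : ℝ) : ℂ) := by
  rw [Complex.mul_conj, Complex.normSq_eq_norm_sq, Complex.ofReal_pow]

set_option maxHeartbeats 1600000 in
/-- **The duality inequality** (Heath-Brown 1992, §11, the "duality principle" step, in finite
form): let `Z`, `S` be finite sets, `a : Z × S → ℂ`, `b : S → ℝ`, `D_i = Σ_{n∈S} a_i(n) b_n`,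
`G_{ij} = Σ_{n∈S} a_i(n)\overline{a_j(n)}`. If `|D_i| ≥ 1/2` on `Z`, `Σ b_n² ≤ B`, all row sums
`Σ_j ‖G_{ij}‖` and column sums `Σ_i ‖G_{ij}‖` are `≤ R₁`, and `0 ≤ m_i ≤ M`, then
`Σ_{i∈Z} m_i ≤ 4 B R₁ M`. [cite: HeathBrown1992PLMS, §11 (11.12)–(11.15)] -/
theorem sum_weights_le_of_duality {ι : Type*} (Z : Finset ι) (S : Finset ℕ) (a : ι → ℕ → ℂ)
    (b : ℕ → ℝ) (m : ι → ℝ) {B R₁ M : ℝ} (hB : 0 ≤ B) (hR₁ : 0 ≤ R₁) (hM : 0 ≤ M)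
    (hm : ∀ i ∈ Z, 0 ≤ m i ∧ m i ≤ M)
    (hD : ∀ i ∈ Z, 1 / 2 ≤ ‖∑ n ∈ S, a i n * b n‖)
    (hb : ∑ n ∈ S, b n ^ 2 ≤ B)
    (hrow : ∀ i ∈ Z, ∑ j ∈ Z, ‖∑ n ∈ S, a i n * (starRingEnd ℂ) (a j n)‖ ≤ R₁)
    (hcol : ∀ j ∈ Z, ∑ i ∈ Z, ‖∑ n ∈ S, a i n * (starRingEnd ℂ) (a j n)‖ ≤ R₁) :
    ∑ i ∈ Z, m i ≤ 4 * B * R₁ * M := by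
  classical
  set D : ι → ℂ := fun i => ∑ n ∈ S, a i n * b n with hDdef
  set G : ι → ι → ℂ := fun i j => ∑ n ∈ S, a i n * (starRingEnd ℂ) (a j n) with hGdef
  set T : ℝ := ∑ i ∈ Z, m i * ‖D i‖ ^ 2 with hTdef
  have hT0 : 0 ≤ T := sum_nonneg fun i hi => mul_nonneg (hm i hi).1 (sq_nonneg _)
  -- (a) `Σ m_i ≤ 4 T`
  have hlow : ∑ i ∈ Z, m i ≤ 4 * T := by
    rw [hTdef, mul_sum]
    refine sum_le_sum fun i hi => ?_
    have h := hD i hi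
    have h2 : 1 / 4 ≤ ‖D i‖ ^ 2 := by nlinarith [norm_nonneg (D i)]
    nlinarith [(hm i hi).1]
  -- (b) `T = Σ_i η_i D_i` with `η_i = m_i \overline{D_i}`
  set η : ι → ℂ := fun i => (m i : ℂ) * (starRingEnd ℂ) (D i) with hηdef
  have hTC : (T : ℂ) = ∑ i ∈ Z, η i * D i := by
    rw [hTdef, Complex.ofReal_sum]
    refine sum_congr rfl fun i _ => ?_
    rw [hηdef]; dsimp only
    rw [mul_assoc, mul_comm ((starRingEnd ℂ) (D i)) (D i), mul_conj_eq_norm_sq, Complex.ofReal_mul]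
  -- (c) swap: `Σ_i η_i D_i = Σ_n b_n c_n`, `c_n = Σ_i η_i a_i(n)`
  set c : ℕ → ℂ := fun n => ∑ i ∈ Z, η i * a i n with hcdef
  have hswap : ∑ i ∈ Z, η i * D i = ∑ n ∈ S, (b n : ℂ) * c n := by
    simp only [hDdef, hcdef, mul_sum]
    rw [sum_comm]
    refine sum_congr rfl fun n _ => sum_congr rfl fun i _ => ?_
    ring
  -- (d) Cauchy–Schwarz: `T² ≤ (Σ b²)(Σ ‖c‖²)`
  have hCS : T ^ 2 ≤ (∑ n ∈ S, b n ^ 2) * ∑ n ∈ S, ‖c n‖ ^ 2 := by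
    have h1 : T ≤ ∑ n ∈ S, |b n| * ‖c n‖ := by
      have : T = ‖(T : ℂ)‖ := by rw [Complex.norm_real, Real.norm_of_nonneg hT0]
      rw [this, hTC, hswap]
      refine (norm_sum_le _ _).trans (sum_le_sum fun n _ => ?_)
      rw [norm_mul, Complex.norm_real, Real.norm_eq_abs]
    have h2 := sum_mul_sq_le_sq_mul_sq S (fun n => |b n|) (fun n => ‖c n‖)
    simp only [sq_abs] at h2
    calc T ^ 2 ≤ (∑ n ∈ S, |b n| * ‖c n‖) ^ 2 := pow_le_pow_left₀ hT0 h1 2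
      _ ≤ _ := h2
  -- (e) `Σ ‖c_n‖² ≤ R₁ Σ ‖η_i‖²`
  have hGram : ∑ n ∈ S, ‖c n‖ ^ 2 ≤ R₁ * ∑ i ∈ Z, ‖η i‖ ^ 2 := by
    -- `Σ_n ‖c_n‖² = re Σ_{i,j} η_i \bar η_j G_{ij}`
    have hid : ((∑ n ∈ S, ‖c n‖ ^ 2 : ℝ) : ℂ) = ∑ i ∈ Z, ∑ j ∈ Z, η i * (starRingEnd ℂ) (η j) * G i j := by
      push_cast
      have h1 : ∀ n ∈ S, ((‖c n‖ : ℂ)) ^ 2 = ∑ i ∈ Z, ∑ j ∈ Z,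
          η i * (starRingEnd ℂ) (η j) * (a i n * (starRingEnd ℂ) (a j n)) := by
        intro n _
        rw [← Complex.ofReal_pow, ← mul_conj_eq_norm_sq, hcdef]; dsimp only
        rw [map_sum, sum_mul_sum]
        refine sum_congr rfl fun i _ => sum_congr rfl fun j _ => ?_
        rw [map_mul]; ring
      rw [sum_congr rfl h1, sum_comm]
      refine sum_congr rfl fun i _ => ?_
      rw [sum_comm]
      refine sum_congr rfl fun j _ => ?_
      rw [hGdef]; dsimp only
      rw [mul_sum]
    have hre : ∑ n ∈ S, ‖c n‖ ^ 2 = (∑ i ∈ Z, ∑ j ∈ Z, η i * (starRingEnd ℂ) (η j) * G i j).re := by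
      rw [← hid, Complex.ofReal_re]
    rw [hre, Complex.re_sum]
    calc ∑ i ∈ Z, (∑ j ∈ Z, η i * (starRingEnd ℂ) (η j) * G i j).re
        ≤ ∑ i ∈ Z, ∑ j ∈ Z, ‖η i‖ * ‖η j‖ * ‖G i j‖ := by
          refine sum_le_sum fun i _ => ?_
          rw [Complex.re_sum]
          refine sum_le_sum fun j _ => ?_
          calc (η i * (starRingEnd ℂ) (η j) * G i j).re ≤ ‖η i * (starRingEnd ℂ) (η j) * G i j‖ := Complex.re_le_norm _
            _ = ‖η i‖ * ‖η j‖ * ‖G i j‖ := by rw [norm_mul, norm_mul, Complex.norm_conj]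
      _ ≤ ∑ i ∈ Z, ∑ j ∈ Z, ((‖η i‖ ^ 2 + ‖η j‖ ^ 2) / 2) * ‖G i j‖ := by
          refine sum_le_sum fun i _ => sum_le_sum fun j _ => ?_
          refine mul_le_mul_of_nonneg_right ?_ (norm_nonneg _)
          nlinarith [sq_nonneg (‖η i‖ - ‖η j‖)]
      _ = (1 / 2) * ∑ i ∈ Z, ‖η i‖ ^ 2 * ∑ j ∈ Z, ‖G i j‖ +
          (1 / 2) * ∑ j ∈ Z, ‖η j‖ ^ 2 * ∑ i ∈ Z, ‖G i j‖ := by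
          have e1 : ∀ i j : ι, ((‖η i‖ ^ 2 + ‖η j‖ ^ 2) / 2) * ‖G i j‖ =
              (1 / 2) * (‖η i‖ ^ 2 * ‖G i j‖) + (1 / 2) * (‖η j‖ ^ 2 * ‖G i j‖) := by
            intro i j; ring
          simp_rw [e1, sum_add_distrib]
          congr 1
          · rw [mul_sum]
            refine sum_congr rfl fun i _ => ?_
            rw [mul_sum, mul_sum]
          · rw [sum_comm, mul_sum]
            refine sum_congr rfl fun j _ => ?_
            rw [mul_sum, mul_sum]
      _ ≤ (1 / 2) * ∑ i ∈ Z, ‖η i‖ ^ 2 * R₁ + (1 / 2) * ∑ j ∈ Z, ‖η j‖ ^ 2 * R₁ := by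
          gcongr with i hi j hj
          · exact hrow i hi
          · exact hcol j hj
      _ = R₁ * ∑ i ∈ Z, ‖η i‖ ^ 2 := by rw [← sum_mul]; ring
  -- (f) `Σ ‖η_i‖² ≤ M T`
  have hη : ∑ i ∈ Z, ‖η i‖ ^ 2 ≤ M * T := by
    rw [hTdef, mul_sum]
    refine sum_le_sum fun i hi => ?_
    rw [hηdef]; dsimp only
    rw [norm_mul, Complex.norm_real, Real.norm_of_nonneg (hm i hi).1, Complex.norm_conj, mul_pow]
    have : m i ^ 2 ≤ M * m i := by nlinarith [(hm i hi).1, (hm i hi).2]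
    nlinarith [sq_nonneg ‖D i‖]
  -- (g) combine: `T² ≤ B R₁ M T`, hence `T ≤ B R₁ M`
  have hT2 : T ^ 2 ≤ B * R₁ * M * T := by
    calc T ^ 2 ≤ (∑ n ∈ S, b n ^ 2) * ∑ n ∈ S, ‖c n‖ ^ 2 := hCS
      _ ≤ B * (R₁ * (M * T)) := by
          refine mul_le_mul hb (hGram.trans (mul_le_mul_of_nonneg_left hη hR₁)) (by positivity) hB
      _ = B * R₁ * M * T := by ring
  have hTle : T ≤ B * R₁ * M := by
    by_contra hcon
    push Not at hcon
    have hpos : 0 < T := lt_of_le_of_lt (by positivity) hcon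
    have : B * R₁ * M * T < T * T := mul_lt_mul_of_pos_right hcon hpos
    nlinarith
  linarith


/-! ### Auxiliary estimates -/

/-- `e^{-y} ≤ y^{-δ}` for `y > 0`, `0 < δ ≤ 1`. [folklore] -/
theorem exp_neg_le_rpow {y δ : ℝ} (hy : 0 < y) (hδ : 0 < δ) (hδ1 : δ ≤ 1) : Real.exp (-y) ≤ y ^ (-δ) := by
  rcases le_or_gt 1 y with h | h
  · -- `e^{-y} ≤ 1/y ≤ y^{-δ}`
    have h1 : Real.exp (-y) ≤ y⁻¹ := by
      rw [Real.exp_neg, inv_le_inv₀ (Real.exp_pos _) hy]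
      have := Real.add_one_le_exp y; linarith
    have h2 : y⁻¹ ≤ y ^ (-δ) := by
      rw [Real.rpow_neg hy.le, inv_le_inv₀ hy (Real.rpow_pos_of_pos hy _)]
      calc y ^ δ ≤ y ^ (1 : ℝ) := Real.rpow_le_rpow_of_exponent_le h hδ1
        _ = y := Real.rpow_one y
    exact h1.trans h2
  · have h1 : Real.exp (-y) ≤ 1 := Real.exp_le_one_iff.2 (by linarith)
    have h2 : 1 ≤ y ^ (-δ) := Real.one_le_rpow_of_pos_of_le_one_of_nonpos hy h.le (by linarith)
    linarith

variable {q : ℕ}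

/-- The `b`-side: `b_n² ≤ e (ψ∗1)(n)² n^{-(1 + 1/log X)}` (`n ≥ 1`, `X ≥ e`, `0 < Y ≤ X`, `R ≥ 1`,
`J ≥ 1`). [folklore] -/
theorem bCoef_sq_le {U V X Y R : ℝ} {J : ℕ} (hY : 0 < Y) (hYX : Y ≤ X) (hX : Real.exp 1 ≤ X) (hR : 1 ≤ R)
    (hJ : 0 < J) {n : ℕ} (hn : 1 ≤ n) :
    bCoef U V X Y R J n ^ 2 ≤ Real.exp 1 * (psiStar U V n ^ 2 * (n : ℝ) ^ (-(1 + 1 / Real.log X))) := by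
  have hn0 : (0 : ℝ) < n := by exact_mod_cast hn
  have he : 1 < Real.exp 1 := by have := Real.exp_one_gt_d9; linarith
  have hX1 : 1 < X := lt_of_lt_of_le he hX
  have hX0 : 0 < X := by linarith
  have hlogX : 1 ≤ Real.log X := by
    rw [← Real.log_exp 1]; exact Real.log_le_log (Real.exp_pos 1) hX
  set δ : ℝ := 1 / Real.log X with hδ
  have hδ0 : 0 < δ := by positivity
  have hδ1 : δ ≤ 1 := by rw [hδ, div_le_one (by linarith)]; exact hlogX
  obtain ⟨hw0, hw1⟩ := wAvg_mem hY hYX hR hJ n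
  rw [bCoef, mul_pow, rW_sq hY hYX hR hJ n]
  have h1 : wAvg X Y R J n / n ≤ Real.exp (-(n / X)) / n := div_le_div_of_nonneg_right hw1 hn0.le
  have h2 : Real.exp (-(n / X)) ≤ Real.exp 1 * (n : ℝ) ^ (-δ) := by
    have h := exp_neg_le_rpow (div_pos hn0 hX0) hδ0 hδ1
    rw [Real.div_rpow hn0.le hX0.le, Real.rpow_neg hX0.le] at h
    have hXδ : X ^ δ = Real.exp 1 := by
      rw [Real.rpow_def_of_pos hX0, hδ]; field_simp
    rw [hXδ] at h
    calc Real.exp (-(n / X)) ≤ (n : ℝ) ^ (-δ) / (Real.exp 1)⁻¹ := h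
      _ = Real.exp 1 * (n : ℝ) ^ (-δ) := by field_simp
  have h3 : wAvg X Y R J n / n ≤ Real.exp 1 * (n : ℝ) ^ (-(1 + δ)) := by
    calc wAvg X Y R J n / n ≤ Real.exp (-(n / X)) / n := h1
      _ ≤ Real.exp 1 * (n : ℝ) ^ (-δ) / n := div_le_div_of_nonneg_right h2 hn0.le
      _ = Real.exp 1 * (n : ℝ) ^ (-(1 + δ)) := by
          rw [show (-(1 + δ) : ℝ) = -δ + (-1) by ring, Real.rpow_add hn0, Real.rpow_neg_one]; ring
  calc psiStar U V n ^ 2 * (wAvg X Y R J n / n) ≤ psiStar U V n ^ 2 * (Real.exp 1 * (n : ℝ) ^ (-(1 + δ))) :=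
        mul_le_mul_of_nonneg_left h3 (sq_nonneg _)
    _ = Real.exp 1 * (psiStar U V n ^ 2 * (n : ℝ) ^ (-(1 + 1 / Real.log X))) := by rw [hδ]; ring

/-- **The `b`-side bound** (Heath-Brown's (11.14), by Motohashi's device, part of the Graham
weights): for `1 ≤ U < V`, `V ≥ 2`, `X ≥ e`, `0 < Y ≤ X`, `R ≥ 1`, `J ≥ 1`:
`Σ_{1 ≤ n ≤ N₁} b_n² ≤ e (1 + log X) · 196 e^{10} (1 + log V/log X)² log V / log²(V/U)`.
[cite: HeathBrown1992PLMS, §11 (11.14)] -/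
theorem sum_bCoef_sq_le {U V X Y R : ℝ} {J : ℕ} (hU : 1 ≤ U) (hUV : U < V) (hV : 2 ≤ V) (hY : 0 < Y)
    (hYX : Y ≤ X) (hX : Real.exp 1 ≤ X) (hR : 1 ≤ R) (hJ : 0 < J) (N₁ : ℕ) :
    ∑ n ∈ Icc 1 N₁, bCoef U V X Y R J n ^ 2 ≤
      Real.exp 1 * ((1 + Real.log X) * (196 * Real.exp 10 * (1 + 1 / Real.log X * Real.log V) ^ 2 *
        Real.log V / Real.log (V / U) ^ 2)) := by
  have he : 1 < Real.exp 1 := by have := Real.exp_one_gt_d9; linarith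
  have hX1 : 1 < X := lt_of_lt_of_le he hX
  have hlogX : 0 < Real.log X := Real.log_pos hX1
  have hδ : 0 < 1 / Real.log X := by positivity
  have h1 : ∑ n ∈ Icc 1 N₁, bCoef U V X Y R J n ^ 2 ≤
      ∑ n ∈ Icc 1 N₁, Real.exp 1 * (psiStar U V n ^ 2 * (n : ℝ) ^ (-(1 + 1 / Real.log X))) :=
    sum_le_sum fun n hn => bCoef_sq_le hY hYX hX hR hJ (mem_Icc.1 hn).1
  have h2 : ∑ n ∈ Icc 1 N₁, Real.exp 1 * (psiStar U V n ^ 2 * (n : ℝ) ^ (-(1 + 1 / Real.log X))) ≤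
      ∑ n ∈ Finset.range (N₁ + 1), Real.exp 1 * (psiStar U V n ^ 2 * (n : ℝ) ^ (-(1 + 1 / Real.log X))) := by
    refine sum_le_sum_of_subset_of_nonneg (fun n hn => ?_) (fun n _ _ => by positivity)
    rw [mem_range]; have := (mem_Icc.1 hn).2; omega
  have h3 := sum_psiStar_sq_mul_rpow_le_explicit hU hUV hV hδ (N₁ + 1)
  rw [← mul_sum] at h1 h2
  rw [← mul_sum] at h2
  have h4 : (1 + 1 / (1 / Real.log X)) = 1 + Real.log X := by field_simp
  rw [h4] at h3
  exact h1.trans (h2.trans (mul_le_mul_of_nonneg_left h3 (Real.exp_nonneg _)))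

/-- The multiplicity of one zero near `1 + iγ`: `m(ρ) ≤ C_loc (1 + r(log q + log(|γ| + 4)))` when
`|ρ − (1 + iγ)| ≤ r ≤ 1/4`. [cite: Bombieri1987GrandCrible, §6 Lemme de densité] -/
theorem zeroOrder_le_of_near {C : ℝ}
    (hC : ∀ (q : ℕ) [NeZero q] (χ : DirichletCharacter ℂ q), χ ≠ 1 → ∀ (v r : ℝ),
      0 < r → r ≤ 1 / 4 → ∀ P : Finset ℂ,
        (∀ ρ ∈ P, χ.LFunction ρ = 0 ∧ ‖ρ - (1 + (v : ℂ) * I)‖ ≤ r) →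
          ∑ ρ ∈ P, (zeroOrder χ ρ : ℝ) ≤ C * (1 + r * (Real.log q + Real.log (|v| + 4))))
    [NeZero q] {χ : DirichletCharacter ℂ q} (hχ : χ ≠ 1) {ρ : ℂ} (h0 : χ.LFunction ρ = 0) {r : ℝ}
    (hr : 0 < r) (hr4 : r ≤ 1 / 4) (hρ : 1 - r ≤ ρ.re) :
    (zeroOrder χ ρ : ℝ) ≤ C * (1 + r * (Real.log q + Real.log (|ρ.im| + 4))) := by
  have hre1 : ρ.re < 1 := by
    by_contra h
    exact DirichletCharacter.LFunction_ne_zero_of_one_le_re χ (Or.inl hχ) (not_lt.1 h) h0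
  have h := hC q χ hχ ρ.im r hr hr4 {ρ} (fun ρ' hρ' => by
    rw [mem_singleton] at hρ'; subst hρ'
    refine ⟨h0, ?_⟩
    calc ‖ρ' - (1 + (ρ'.im : ℂ) * I)‖ ≤ |(ρ' - (1 + (ρ'.im : ℂ) * I)).re| + |(ρ' - (1 + (ρ'.im : ℂ) * I)).im| :=
          Complex.norm_le_abs_re_add_abs_im _
      _ = 1 - ρ'.re := by
          simp only [Complex.sub_re, Complex.add_re, Complex.one_re, Complex.mul_re, Complex.ofReal_re,
            Complex.I_re, mul_zero, Complex.ofReal_im, Complex.I_im, mul_one, sub_self, add_zero,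
            Complex.sub_im, Complex.add_im, Complex.one_im, Complex.mul_im, zero_add, abs_zero]
          rw [abs_of_nonpos (by linarith)]; ring
      _ ≤ r := by linarith)
  rwa [sum_singleton] at h

/-- The kernel is invariant under complex conjugation of its argument. [folklore] -/
theorem kernel_conj (X Y R : ℝ) (hX : 0 ≤ X) (hY : 0 ≤ Y) (hR : 0 ≤ R) (J : ℕ) (w : ℂ) :
    kernel X Y R J ((starRingEnd ℂ) w) = kernel X Y R J w := by
  have hcpow : ∀ {Z : ℝ}, 0 ≤ Z → ∀ z : ℂ, (Z : ℂ) ^ ((starRingEnd ℂ) z) = (starRingEnd ℂ) ((Z : ℂ) ^ z) := by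
    intro Z hZ z
    rw [Complex.cpow_conj _ _ (by rw [Complex.arg_ofReal_of_nonneg hZ]; exact Real.pi_ne_zero.symm),
      Complex.conj_ofReal]
  have hsinc : sincJ R J ((starRingEnd ℂ) w) = (starRingEnd ℂ) (sincJ R J w) := by
    rw [sincJ, sincJ, map_mul, map_inv₀, Complex.conj_natCast, map_sum]
    congr 1
    refine sum_congr rfl fun j _ => ?_
    rw [← hcpow hR]
    congr 1
    simp [map_neg, map_div₀, map_mul]
  unfold kernel
  rw [hcpow hX, hcpow hY, Complex.Gamma_conj, ← map_sub, ← map_mul, Complex.norm_conj, hsinc,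
    Complex.norm_conj]

/-- `(1 + λ)² ≤ 100 e^{λ/5}` for `λ ≥ 0`. [folklore] -/
theorem one_add_sq_le_exp {lam : ℝ} (hlam : 0 ≤ lam) : (1 + lam) ^ 2 ≤ 100 * Real.exp (lam / 5) := by
  have h1 : 1 + lam ≤ 10 * Real.exp (lam / 10) := by
    have := Real.add_one_le_exp (lam / 10); linarith
  calc (1 + lam) ^ 2 ≤ (10 * Real.exp (lam / 10)) ^ 2 := pow_le_pow_left₀ (by linarith) h1 2
    _ = 100 * Real.exp (lam / 5) := by
        rw [mul_pow, ← Real.exp_nat_mul]; norm_num; ring_nf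


/-! ### The theorem -/

/-- `⌊X⌋² / X ≥ X − 2` for `X ≥ 1`, in the form `e^{-⌊X⌋²/X} ≤ e^{2 − X}`. [folklore] -/
theorem exp_neg_floor_sq_div_le {X : ℝ} (hX : 1 ≤ X) :
    Real.exp (-(((⌊X⌋₊ ^ 2 : ℕ) : ℝ)) / X) ≤ Real.exp (2 - X) := by
  have hX0 : 0 < X := by linarith
  refine Real.exp_le_exp.2 ?_
  rw [div_le_iff₀ hX0, neg_le]
  have hfl : X - 1 ≤ (⌊X⌋₊ : ℝ) := by have := Nat.lt_floor_add_one X; linarith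
  have h1 : (X - 1) ^ 2 ≤ ((⌊X⌋₊ ^ 2 : ℕ) : ℝ) := by
    push_cast; exact pow_le_pow_left₀ (by linarith) hfl 2
  nlinarith

/-- `2 − i − \bar j = \overline{2 − j − \bar i}`. [folklore] -/
theorem two_sub_sub_conj (i j : ℂ) : 2 - i - (starRingEnd ℂ) j = (starRingEnd ℂ) (2 - j - (starRingEnd ℂ) i) := by
  simp [map_sub, map_ofNat]; ring

set_option maxHeartbeats 40000000 in
/-- **Log-free zero-density estimate for a single primitive character (low height, `q`-aspect).**
There are absolute `K, q₀` such that for every primitive character `χ` modulo `q ≥ q₀`, every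
`0 ≤ λ ≤ (log q)/1000`, and every finite set `Z` of zeros `ρ = β + iγ` of `L(s, χ)` with
`β ≥ 1 − λ/log q` and `|γ| ≤ q^{1/1000}`,

  `Σ_{ρ ∈ Z} m(ρ) ≤ K e^{3λ}`

(`m(ρ)` the multiplicity). This is Heath-Brown's Lemma 11.1 (PLMS 64 (1992), §11: Graham's
weights, the zero detector (11.8)–(11.9), the duality principle (11.11)–(11.15) and the Gram
computation (11.16)–(11.17)) for ONE character, where the Gram matrix carries the pole of `ζ`;
the resulting `1/|γ − γ'|` kernel is tamed by the scale-averaged weights of part IV (a smooth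
cutoff on the scale `log q`), which is what keeps the estimate free of `log log q`.
[cite: HeathBrown1992PLMS, §11 Lemma 11.1] -/
theorem logFreeDensity_single :
    ∃ K q₀ : ℝ, 0 < K ∧ ∀ (q : ℕ) [NeZero q] (χ : DirichletCharacter ℂ q), χ.IsPrimitive → q₀ ≤ (q : ℝ) →
      ∀ lam : ℝ, 0 ≤ lam → lam ≤ Real.log q / 1000 →
        ∀ Z : Finset ℂ, (∀ ρ ∈ Z, χ.LFunction ρ = 0 ∧ 1 - lam / Real.log q ≤ ρ.re ∧
            |ρ.im| ≤ (q : ℝ) ^ (1 / 1000 : ℝ)) →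
          ∑ ρ ∈ Z, (zeroOrder χ ρ : ℝ) ≤ K * Real.exp (3 * lam) := by
  classical
  /- ── absolute constants ── -/
  obtain ⟨C_R, hC_R, hrowK⟩ := rowSum_kernel_le
  obtain ⟨C_loc, hC_loc, hloc⟩ := exists_sum_zeroOrder_near_le
  obtain ⟨C_G, hC_G, hDq⟩ := exists_totient_div_mul_Dq1_le
  obtain ⟨C_d, hC_d1, hdiv⟩ := Literature.NumberTheory.Sieve.exists_card_divisors_le_mul_rpow
    (ε := 1 / 1000) (by norm_num)
  have hC_d0 : 0 < C_d := by linarith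
  set K_det : ℝ := 512 * (256 * π ^ 2 * Real.exp 1 / 3) * 3 with hK_det
  have hK_det0 : 0 < K_det := by rw [hK_det]; positivity
  set B₀ : ℝ := Real.exp 1 * (196 * Real.exp 10 * (29 / 28) ^ 2 * 1200) with hB₀
  have hB₀0 : 0 < B₀ := by rw [hB₀]; positivity
  set C_A : ℝ := 49 * 10 ^ 6 * (1 / 1000 + 6 / 5 * C_G) with hC_A
  have hC_A0 : 0 < C_A := by rw [hC_A]; positivity
  set K_rem : ℝ := 512 * (4096 * π ^ 2 / 3) * 4 with hK_rem
  have hK_rem0 : 0 < K_rem := by rw [hK_rem]; positivity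
  -- eventual inequalities
  obtain ⟨L₁, -, hL₁⟩ := SiegelZero.exists_mul_pow_le_exp (16 * K_det) 1 (93 / 2000) (by norm_num)
  obtain ⟨t₁, ht₁0, ht₁⟩ := SiegelZero.exists_mul_rpow_le_exp (16 * Real.exp 1) (81 / 10) 1 one_pos
  obtain ⟨t₂, ht₂0, ht₂⟩ := SiegelZero.exists_mul_rpow_le_exp (32 * Real.exp 2) (26 / 25) 1 one_pos
  obtain ⟨L₅, -, hL₅⟩ := SiegelZero.exists_mul_pow_le_exp (16 * B₀ * C_loc * K_rem * C_d) 1 (3 / 1000) (by norm_num)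
  obtain ⟨t₃, ht₃0, ht₃⟩ := SiegelZero.exists_mul_rpow_le_exp (64 * B₀ * C_loc * Real.exp 2) (51 / 25) 1 one_pos
  set L₀ : ℝ := max (max (max 100 L₁) (max (100 * t₁) t₂)) (max L₅ t₃) with hL₀
  set K : ℝ := 8 * 1003 * 3 * 100 * B₀ * C_loc * C_A * C_R with hK
  refine ⟨K, Real.exp L₀, by positivity, ?_⟩
  intro q _ χ hprim hq0 lam hlam hlamL Z hZ
  /- ── sizes of `q` and `L` ── -/
  have hqpos : (0 : ℝ) < q := lt_of_lt_of_le (Real.exp_pos _) hq0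
  set L : ℝ := Real.log q with hLdef
  have hL0L : L₀ ≤ L := by
    rw [hLdef, ← Real.log_exp L₀]; exact Real.log_le_log (Real.exp_pos _) hq0
  have hL100 : 100 ≤ L := le_trans (by simp [hL₀]) hL0L
  have hLL₁ : L₁ ≤ L := le_trans (by simp [hL₀]) hL0L
  have hLt₁ : 100 * t₁ ≤ L := le_trans (by simp [hL₀]) hL0L
  have hLt₂ : t₂ ≤ L := le_trans (by simp [hL₀]) hL0L
  have hLL₅ : L₅ ≤ L := le_trans (by simp [hL₀]) hL0L
  have hLt₃ : t₃ ≤ L := le_trans (by simp [hL₀]) hL0L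
  have hL0 : 0 < L := by linarith
  have hL1 : 1 ≤ L := by linarith
  have hqexp : (q : ℝ) = Real.exp L := by rw [hLdef, Real.exp_log hqpos]
  have hq8r : (8 : ℝ) ≤ q := by
    rw [hqexp]
    have : Real.exp 3 ≤ Real.exp L := Real.exp_le_exp.2 (by linarith)
    have h3 : (8 : ℝ) ≤ Real.exp 3 := by
      have := Real.add_one_le_exp (3 : ℝ)
      have e3 : Real.exp 3 = Real.exp 1 * Real.exp 1 * Real.exp 1 := by
        rw [← Real.exp_add, ← Real.exp_add]; norm_num
      rw [e3]; nlinarith [Real.exp_one_gt_d9, Real.exp_pos (1 : ℝ)]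
    linarith
  have hq8 : 8 ≤ q := by exact_mod_cast hq8r
  have hq1 : 1 < q := by omega
  have hqne : q ≠ 0 := by omega
  have hχ : χ ≠ 1 := ExplicitPsiChar.ne_one_of_isPrimitive hprim hq1
  have hlamL' : lam / L ≤ 1 / 1000 := by rw [div_le_iff₀ hL0]; linarith
  /- ── parameters ── -/
  set W : ℝ := Real.exp (L / 1000) with hW
  set R : ℝ := Real.exp (L / 1000) with hR
  set Y : ℝ := Real.exp (3 * L / 100) with hY
  set U : ℝ := Real.exp (L / 25) with hU
  set V : ℝ := Real.exp (L / 20) with hV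
  set X : ℝ := Real.exp (7 * L / 5) with hX
  set T₀ : ℝ := Real.exp (L / 1000) with hT₀
  set J : ℕ := ⌈L / 250⌉₊ + 1 with hJ
  set N₁ : ℕ := ⌊X⌋₊ ^ 2 with hN₁
  have hW1 : 1 < W := Real.one_lt_exp_iff.2 (by positivity)
  have hR1 : 1 < R := Real.one_lt_exp_iff.2 (by positivity)
  have hR0 : 0 < R := Real.exp_pos _
  have hU1 : 1 ≤ U := Real.one_le_exp (by positivity)
  have hUV : U < V := Real.exp_lt_exp.2 (by linarith)
  have hV2 : 2 ≤ V := by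
    rw [hV]; have := Real.add_one_le_exp (L / 20); linarith
  have hY0 : 0 < Y := Real.exp_pos _
  have hY1 : 1 ≤ Y := Real.one_le_exp (by positivity)
  have hRY : R ^ 2 ≤ Y := by
    rw [hR, hY, ← Real.exp_nat_mul]; exact Real.exp_le_exp.2 (by push_cast; linarith)
  have hYX : Y ≤ X := Real.exp_le_exp.2 (by linarith)
  have hX1 : 1 ≤ X := hY1.trans hYX
  have hX0 : 0 < X := by linarith
  have hXe : Real.exp 1 ≤ X := Real.exp_le_exp.2 (by linarith)
  have hJ0 : 0 < J := by rw [hJ]; omega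
  have hlogR : Real.log R = L / 1000 := by rw [hR, Real.log_exp]
  have hJR : 4 * Real.log R ≤ J := by
    rw [hlogR, hJ]; push_cast
    have := Nat.le_ceil (L / 250); linarith
  have hT₀q : (q : ℝ) ^ (1 / 1000 : ℝ) = T₀ := by
    rw [hT₀, Real.rpow_def_of_pos hqpos, ← hLdef]; ring_nf
  have hT₀1 : 1 ≤ T₀ := Real.one_le_exp (by positivity)
  have hlogT₀ : Real.log (T₀ + 4) ≤ L / 4 := by
    have h1 : T₀ + 4 ≤ T₀ * Real.exp 2 := by
      have : (5 : ℝ) ≤ Real.exp 2 := by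
        have e2 : Real.exp 2 = Real.exp 1 * Real.exp 1 := by rw [← Real.exp_add]; norm_num
        rw [e2]; nlinarith [Real.exp_one_gt_d9, Real.exp_pos (1 : ℝ)]
      nlinarith
    calc Real.log (T₀ + 4) ≤ Real.log (T₀ * Real.exp 2) := Real.log_le_log (by linarith) h1
      _ = L / 1000 + 2 := by rw [Real.log_mul (by linarith) (Real.exp_pos _).ne', hT₀, Real.log_exp, Real.log_exp]
      _ ≤ L / 4 := by linarith
  /- ── the zeros ── -/
  have hZ' : ∀ ρ ∈ Z, χ.LFunction ρ = 0 ∧ 1 - lam / L ≤ ρ.re ∧ |ρ.im| ≤ T₀ := fun ρ h =>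
    ⟨(hZ ρ h).1, (hZ ρ h).2.1, hT₀q ▸ (hZ ρ h).2.2⟩
  have hZre : ∀ ρ ∈ Z, 999 / 1000 ≤ ρ.re ∧ ρ.re < 1 := by
    intro ρ h
    refine ⟨by linarith [(hZ' ρ h).2.1], ?_⟩
    by_contra hre
    exact DirichletCharacter.LFunction_ne_zero_of_one_le_re χ (Or.inl hχ) (not_lt.1 hre) (hZ' ρ h).1
  /- ── Step 1: the detector ── -/
  have hdet : ∀ ρ ∈ Z, 1 / 2 ≤ ‖∑ n ∈ Icc 1 N₁, aCoef χ W X Y R J ρ n * (bCoef U V X Y R J n : ℂ)‖ := by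
    intro ρ hρ
    obtain ⟨h0, hre, him⟩ := hZ' ρ hρ
    obtain ⟨hre', hre1⟩ := hZre ρ hρ
    have hsum : ∑ n ∈ Icc 1 N₁, aCoef χ W X Y R J ρ n * (bCoef U V X Y R J n : ℂ) =
        detector χ U V W X Y R J N₁ ρ := by
      rw [detector]
      exact sum_congr rfl fun n hn => aCoef_mul_bCoef χ hY0 hYX hR1.le hJ0 ρ (mem_Icc.1 hn).1
    rw [hsum]
    have hE := norm_detector_add_one_le χ hχ hq8 hU1 hUV hW1 hR1.le hRY hYX hJ0 N₁ h0
      (by linarith) hre1.le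
    -- the four terms
    have hS1 : 512 * detConst q V W (X / R ^ 2) ρ ≤ 1 / 8 := by
      have hqpow : (q : ℝ) ^ (5 / 4 - ρ.re) ≤ Real.exp ((1 / 4 + 1 / 1000) * L) := by
        rw [Real.rpow_def_of_pos hqpos, ← hLdef]
        exact Real.exp_le_exp.2 (by nlinarith)
      have hγ : 2 + |ρ.im| ≤ 3 * Real.exp (L / 1000) := by rw [← hT₀]; linarith
      have hVW : (⌊V⌋₊ : ℝ) * ⌊W⌋₊ ≤ Real.exp (L / 20 + L / 1000) := by
        rw [Real.exp_add]
        exact mul_le_mul (Nat.floor_le (by positivity)) (Nat.floor_le (by positivity)) (by positivity) (by positivity)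
      have hXR : (X / R ^ 2) ^ (-(1 / 4 : ℝ)) = Real.exp (-((7 / 5 - 2 / 1000) * L / 4)) := by
        have : X / R ^ 2 = Real.exp ((7 / 5 - 2 / 1000) * L) := by
          rw [hX, hR, ← Real.exp_nat_mul, ← Real.exp_sub]; congr 1; push_cast; ring
        rw [this, Real.rpow_def_of_pos (Real.exp_pos _), Real.log_exp]; congr 1; ring
      have hL1' : Real.log q + 1 ≤ 2 * L := by rw [← hLdef]; linarith
      have hprod : 512 * detConst q V W (X / R ^ 2) ρ ≤ K_det * (2 * L) * Real.exp (-(93 / 2000) * L) := by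
        unfold detConst
        rw [hXR]
        calc 512 * (256 * π ^ 2 * Real.exp 1 / 3 * (q : ℝ) ^ (5 / 4 - ρ.re) * (Real.log q + 1) * (2 + |ρ.im|) *
              ((⌊V⌋₊ : ℝ) * ⌊W⌋₊) * Real.exp (-((7 / 5 - 2 / 1000) * L / 4)))
            ≤ 512 * (256 * π ^ 2 * Real.exp 1 / 3 * Real.exp ((1 / 4 + 1 / 1000) * L) * (2 * L) *
              (3 * Real.exp (L / 1000)) * Real.exp (L / 20 + L / 1000) * Real.exp (-((7 / 5 - 2 / 1000) * L / 4))) := by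
              gcongr
          _ = K_det * (2 * L) * (Real.exp ((1 / 4 + 1 / 1000) * L) * Real.exp (L / 1000) *
              Real.exp (L / 20 + L / 1000) * Real.exp (-((7 / 5 - 2 / 1000) * L / 4))) := by rw [hK_det]; ring
          _ = K_det * (2 * L) * Real.exp (-(93 / 2000) * L) := by
              rw [← Real.exp_add, ← Real.exp_add, ← Real.exp_add]; congr 2; ring
      have hev := hL₁ L hLL₁
      rw [pow_one] at hev
      have hexp : Real.exp (-(93 / 2000) * L) = (Real.exp (93 / 2000 * L))⁻¹ := by
        rw [← Real.exp_neg]; congr 1; ring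
      rw [hexp] at hprod
      have hpos : 0 < Real.exp (93 / 2000 * L) := Real.exp_pos _
      calc 512 * detConst q V W (X / R ^ 2) ρ ≤ K_det * (2 * L) * (Real.exp (93 / 2000 * L))⁻¹ := hprod
        _ ≤ 1 / 8 := by
            rw [← div_eq_mul_inv, div_le_iff₀ hpos]; linarith
    have hS2 : R ^ 2 / Y ≤ 1 / 8 := by
      have : R ^ 2 / Y = Real.exp (-(7 / 250 * L)) := by
        rw [hR, hY, ← Real.exp_nat_mul, ← Real.exp_sub]; congr 1; push_cast; ring
      rw [this, Real.exp_neg, inv_le_comm₀ (Real.exp_pos _) (by norm_num)]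
      have h8 : (8 : ℝ) ≤ Real.exp (7 / 250 * L) := by
        have h8eq : Real.exp (Real.log 2 * 3) = 8 := by
          rw [Real.exp_mul, Real.exp_log (by norm_num : (0 : ℝ) < 2)]; norm_num
        have h8' : Real.exp (Real.log 2 * 3) ≤ Real.exp (7 / 250 * L) :=
          Real.exp_le_exp.2 (by nlinarith [Real.log_two_lt_d9])
        linarith
      simpa using h8
    have hS3 : (⌊V⌋₊ : ℝ) * ⌊W⌋₊ * ((1 + Y) * Real.exp (-(⌊U⌋₊ : ℝ) / Y)) ≤ 1 / 8 := by
      set t : ℝ := Real.exp (L / 100) with ht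
      have ht1 : 1 ≤ t := Real.one_le_exp (by positivity)
      have htt₁ : t₁ ≤ t := by
        have : L / 100 ≤ t := by rw [ht]; have := Real.add_one_le_exp (L / 100); linarith
        linarith
      -- `⌊U⌋/Y ≥ t - 1`
      have hUY : t - 1 ≤ (⌊U⌋₊ : ℝ) / Y := by
        rw [le_div_iff₀ hY0]
        have hfl : U - 1 ≤ (⌊U⌋₊ : ℝ) := by have := Nat.lt_floor_add_one U; linarith
        have hUeq : U = t * Y := by rw [hU, ht, hY, ← Real.exp_add]; congr 1; ring
        nlinarith
      have hexpU : Real.exp (-(⌊U⌋₊ : ℝ) / Y) ≤ Real.exp (1 - t) := by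
        refine Real.exp_le_exp.2 ?_; rw [neg_div]; linarith
      have hVW : (⌊V⌋₊ : ℝ) * ⌊W⌋₊ * (1 + Y) ≤ 2 * t ^ (81 / 10 : ℝ) := by
        have h1 : (⌊V⌋₊ : ℝ) * ⌊W⌋₊ ≤ V * W :=
          mul_le_mul (Nat.floor_le (by positivity)) (Nat.floor_le (by positivity)) (by positivity) (by positivity)
        have h2 : 1 + Y ≤ 2 * Y := by linarith
        have h3 : V * W * (2 * Y) = 2 * t ^ (81 / 10 : ℝ) := by
          rw [hV, hW, hY, ht, ← Real.exp_mul]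
          calc Real.exp (L / 20) * Real.exp (L / 1000) * (2 * Real.exp (3 * L / 100))
              = 2 * Real.exp (L / 20 + L / 1000 + 3 * L / 100) := by rw [Real.exp_add, Real.exp_add]; ring
            _ = 2 * Real.exp (L / 100 * (81 / 10)) := by congr 2; ring
        calc (⌊V⌋₊ : ℝ) * ⌊W⌋₊ * (1 + Y) ≤ V * W * (2 * Y) :=
              mul_le_mul h1 h2 (by positivity) (by positivity)
          _ = 2 * t ^ (81 / 10 : ℝ) := h3
      have hev := ht₁ t htt₁
      calc (⌊V⌋₊ : ℝ) * ⌊W⌋₊ * ((1 + Y) * Real.exp (-(⌊U⌋₊ : ℝ) / Y))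
          = (⌊V⌋₊ : ℝ) * ⌊W⌋₊ * (1 + Y) * Real.exp (-(⌊U⌋₊ : ℝ) / Y) := by ring
        _ ≤ 2 * t ^ (81 / 10 : ℝ) * Real.exp (1 - t) :=
            mul_le_mul hVW hexpU (Real.exp_nonneg _) (by positivity)
        _ = (16 * Real.exp 1 * t ^ (81 / 10 : ℝ)) * (Real.exp (1 * t))⁻¹ * (Real.exp 1 / 8) / Real.exp 1 := by
            rw [Real.exp_sub, one_mul]; field_simp; ring
        _ ≤ Real.exp (1 * t) * (Real.exp (1 * t))⁻¹ * (Real.exp 1 / 8) / Real.exp 1 := by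
            gcongr
        _ = 1 / 8 := by field_simp
    have hS4 : 2 * ((⌊V⌋₊ : ℝ) * ⌊W⌋₊ * ((1 + X) * Real.exp (-(N₁ : ℝ) / X))) ≤ 1 / 8 := by
      have htt₂ : t₂ ≤ X := by
        have : 7 * L / 5 ≤ X := by rw [hX]; have := Real.add_one_le_exp (7 * L / 5); linarith
        linarith
      have hN : Real.exp (-(N₁ : ℝ) / X) ≤ Real.exp (2 - X) := by
        have := exp_neg_floor_sq_div_le hX1
        rw [hN₁]; exact_mod_cast this
      have hVW : 2 * ((⌊V⌋₊ : ℝ) * ⌊W⌋₊ * (1 + X)) ≤ 4 * X ^ (26 / 25 : ℝ) := by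
        have h1 : (⌊V⌋₊ : ℝ) * ⌊W⌋₊ ≤ V * W :=
          mul_le_mul (Nat.floor_le (by positivity)) (Nat.floor_le (by positivity)) (by positivity) (by positivity)
        have h2 : 1 + X ≤ 2 * X := by linarith
        have h3 : V * W * (2 * X) ≤ 2 * X ^ (26 / 25 : ℝ) := by
          rw [hV, hW, hX, ← Real.exp_mul]
          have : Real.exp (L / 20 + L / 1000 + 7 * L / 5) ≤ Real.exp (7 * L / 5 * (26 / 25)) :=
            Real.exp_le_exp.2 (by nlinarith)
          calc Real.exp (L / 20) * Real.exp (L / 1000) * (2 * Real.exp (7 * L / 5))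
              = 2 * Real.exp (L / 20 + L / 1000 + 7 * L / 5) := by rw [Real.exp_add, Real.exp_add]; ring
            _ ≤ 2 * Real.exp (7 * L / 5 * (26 / 25)) := by linarith
        nlinarith [mul_le_mul h1 h2 (by positivity) (by positivity)]
      have hev := ht₂ X htt₂
      calc 2 * ((⌊V⌋₊ : ℝ) * ⌊W⌋₊ * ((1 + X) * Real.exp (-(N₁ : ℝ) / X)))
          = 2 * ((⌊V⌋₊ : ℝ) * ⌊W⌋₊ * (1 + X)) * Real.exp (-(N₁ : ℝ) / X) := by ring
        _ ≤ 4 * X ^ (26 / 25 : ℝ) * Real.exp (2 - X) := mul_le_mul hVW hN (Real.exp_nonneg _) (by positivity)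
        _ = (32 * Real.exp 2 * X ^ (26 / 25 : ℝ)) * (Real.exp (1 * X))⁻¹ / 8 := by
            rw [Real.exp_sub, one_mul]; field_simp; ring
        _ ≤ Real.exp (1 * X) * (Real.exp (1 * X))⁻¹ / 8 := by gcongr
        _ = 1 / 8 := by field_simp
    have hE' : ‖detector χ U V W X Y R J N₁ ρ + 1‖ ≤ 1 / 2 := by linarith
    have := norm_sub_le (detector χ U V W X Y R J N₁ ρ + 1) (detector χ U V W X Y R J N₁ ρ)
    rw [add_sub_cancel_left, norm_one] at this
    linarith
  /- ── Step 2: the `b`-side ── -/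
  have hb : ∑ n ∈ Icc 1 N₁, bCoef U V X Y R J n ^ 2 ≤ B₀ := by
    refine (sum_bCoef_sq_le hU1 hUV hV2 hY0 hYX hXe hR1.le hJ0 N₁).trans ?_
    have hlogX : Real.log X = 7 * L / 5 := by rw [hX, Real.log_exp]
    have hlogV : Real.log V = L / 20 := by rw [hV, Real.log_exp]
    have hlogVU : Real.log (V / U) = L / 100 := by
      rw [hV, hU, ← Real.exp_sub, Real.log_exp]; ring
    rw [hlogX, hlogV, hlogVU, hB₀]
    refine mul_le_mul_of_nonneg_left ?_ (Real.exp_nonneg _)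
    have e1 : (1 + 1 / (7 * L / 5) * (L / 20)) = 29 / 28 := by field_simp; ring
    rw [e1]
    have e2 : (1 + 7 * L / 5) * (196 * Real.exp 10 * (29 / 28) ^ 2 * (L / 20) / (L / 100) ^ 2) =
        196 * Real.exp 10 * (29 / 28) ^ 2 * (500 / L + 700) := by field_simp; ring
    rw [e2]
    have h3 : 500 / L + 700 ≤ 1200 := by
      have : 500 / L ≤ 500 := by rw [div_le_iff₀ hL0]; nlinarith
      linarith
    have h0 : 0 ≤ 196 * Real.exp 10 * (29 / 28 : ℝ) ^ 2 := by positivity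
    nlinarith
  /- ── Step 3: the multiplicities ── -/
  set M : ℝ := C_loc * (3 + 2 * lam) with hM
  have hM0 : 0 ≤ M := by rw [hM]; positivity
  have hm : ∀ i ∈ Z, 0 ≤ (zeroOrder χ i : ℝ) ∧ (zeroOrder χ i : ℝ) ≤ M := by
    intro i hi
    obtain ⟨h0, hre, him⟩ := hZ' i hi
    refine ⟨Nat.cast_nonneg _, ?_⟩
    have hr : 0 < (lam + 1) / L := by positivity
    have hr4 : (lam + 1) / L ≤ 1 / 4 := by
      rw [div_le_iff₀ hL0]; linarith
    have hρ : 1 - (lam + 1) / L ≤ i.re := by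
      have : lam / L ≤ (lam + 1) / L := div_le_div_of_nonneg_right (by linarith) hL0.le
      linarith
    refine (zeroOrder_le_of_near hloc hχ h0 hr hr4 hρ).trans ?_
    have hlogγ : Real.log (|i.im| + 4) ≤ L / 4 := (Real.log_le_log (by positivity) (by linarith)).trans hlogT₀
    rw [← hLdef, hM]
    refine mul_le_mul_of_nonneg_left ?_ hC_loc.le
    have h1 : (lam + 1) / L * (L + Real.log (|i.im| + 4)) ≤ (lam + 1) / L * (L + L / 4) :=
      mul_le_mul_of_nonneg_left (by linarith) hr.le
    have h2 : (lam + 1) / L * (L + L / 4) = (lam + 1) * (5 / 4) := by field_simp; ring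
    linarith
  /- ── Step 4: the Gram matrix ── -/
  set A_D : ℝ := (q.totient : ℝ) / q * ‖Fpoly (1 : DirichletCharacter ℂ q) 1 W W 1‖ with hA_D
  have hA_D0 : 0 ≤ A_D := by rw [hA_D]; positivity
  have hA_DL : A_D ≤ C_A / L := by
    obtain ⟨hD0, hDle⟩ := hDq q hqne W hW1
    have hnorm : ‖Fpoly (1 : DirichletCharacter ℂ q) 1 W W 1‖ = Dq1 q W := by
      rw [Fpoly_one_eq_Dq1, Complex.norm_real, Real.norm_of_nonneg hD0]
    rw [hA_D, hnorm]
    refine hDle.trans ?_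
    have hlogW : Real.log W = L / 1000 := by rw [hW, Real.log_exp]
    rw [hlogW, ← hLdef, hC_A, div_le_div_iff₀ (by positivity) hL0]
    -- `49 (L/1000 + C_G (7 + L)) L ≤ 49·10⁶ (1/1000 + 6/5 C_G) (L/1000)²`
    have h35 : 7 + L ≤ 6 / 5 * L := by linarith
    have h1 : C_G * (7 + L) ≤ C_G * (6 / 5 * L) := mul_le_mul_of_nonneg_left h35 hC_G
    nlinarith [h1, hL0]
  set REMmax : ℝ := K_rem * C_d * Real.exp (-(3 / 1000) * L) + 4 * X ^ (26 / 25 : ℝ) * Real.exp (2 - X) with hREMmax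
  have hREMmax0 : 0 ≤ REMmax := by rw [hREMmax]; positivity
  -- the per-pair bound
  have hpair : ∀ i ∈ Z, ∀ j ∈ Z,
      ‖∑ n ∈ Icc 1 N₁, aCoef χ W X Y R J i n * (starRingEnd ℂ) (aCoef χ W X Y R J j n)‖ ≤
        A_D * kernel X Y R J (2 - i - (starRingEnd ℂ) j) + REMmax := by
    intro i hi j hj
    obtain ⟨hire, hire1⟩ := hZre i hi
    obtain ⟨hjre, hjre1⟩ := hZre j hj
    have him := (hZ' i hi).2.2
    have hjm := (hZ' j hj).2.2
    set κ : ℂ := i + (starRingEnd ℂ) j - 1 with hκdef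
    have hκre : κ.re = i.re + j.re - 1 := by
      rw [hκdef]; simp only [Complex.sub_re, Complex.add_re, Complex.conj_re, Complex.one_re]
    have hκ : 1 / 2 ≤ κ.re := by rw [hκre]; linarith
    have hκ1 : κ.re < 1 := by rw [hκre]; linarith
    have hκnorm : 1 + ‖κ‖ ≤ 4 * T₀ := by
      have h1 : ‖κ‖ ≤ |κ.re| + |κ.im| := Complex.norm_le_abs_re_add_abs_im κ
      have h2 : |κ.re| ≤ 1 := by rw [hκre, abs_le]; constructor <;> linarith
      have h3 : |κ.im| ≤ 2 * T₀ := by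
        have : κ.im = i.im - j.im := by
          rw [hκdef]; simp only [Complex.sub_im, Complex.add_im, Complex.conj_im, Complex.one_im]; ring
        rw [this]
        calc |i.im - j.im| ≤ |i.im| + |j.im| := abs_sub _ _
          _ ≤ T₀ + T₀ := add_le_add him hjm
          _ = 2 * T₀ := by ring
      linarith
    have hsum : ∑ n ∈ Icc 1 N₁, aCoef χ W X Y R J i n * (starRingEnd ℂ) (aCoef χ W X Y R J j n) =
        gramFin (q := q) W X Y R J N₁ κ :=
      sum_congr rfl fun n hn => aCoef_mul_conj_aCoef χ hY0 hYX hR1.le hJ0 i j (mem_Icc.1 hn).1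
    rw [hsum]
    have hG := norm_gramFin_le hqne hW1 hR1.le hRY hYX hJ0 N₁ hκ hκ1
    have h1κ : 1 - κ = 2 - i - (starRingEnd ℂ) j := by rw [hκdef]; ring
    rw [h1κ] at hG
    refine hG.trans ?_
    rw [add_assoc]
    refine add_le_add (le_of_eq (by rw [hA_D])) ?_
    -- the two remainder terms
    have hrem1 : 512 * (4096 * π ^ 2 / 3 * 2 ^ q.primeFactors.card * (1 + ‖κ‖) * ((⌊W⌋₊ : ℝ) * ⌊W⌋₊) *
        (R ^ (1 / 2 : ℝ) * Y ^ (-(1 / 4 : ℝ)))) ≤ K_rem * C_d * Real.exp (-(3 / 1000) * L) := by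
      have hω : (2 : ℝ) ^ q.primeFactors.card ≤ C_d * T₀ := by
        have h1 : (2 : ℝ) ^ q.primeFactors.card ≤ (q.divisors.card : ℝ) := by
          exact_mod_cast GoldbachSeries.two_pow_card_primeFactors_le_card_divisors hqne
        have h2 := hdiv q hqne
        rw [hT₀q] at h2
        exact h1.trans h2
      have hWW : (⌊W⌋₊ : ℝ) * ⌊W⌋₊ ≤ Real.exp (2 * L / 1000) := by
        have h1 : (⌊W⌋₊ : ℝ) ≤ W := Nat.floor_le (by positivity)
        calc (⌊W⌋₊ : ℝ) * ⌊W⌋₊ ≤ W * W := mul_le_mul h1 h1 (by positivity) (by positivity)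
          _ = Real.exp (2 * L / 1000) := by rw [hW, ← Real.exp_add]; congr 1; ring
      have hRY' : R ^ (1 / 2 : ℝ) * Y ^ (-(1 / 4 : ℝ)) = Real.exp (L / 2000 - 3 * L / 400) := by
        rw [hR, hY, Real.rpow_def_of_pos (Real.exp_pos _), Real.rpow_def_of_pos (Real.exp_pos _),
          Real.log_exp, Real.log_exp, ← Real.exp_add]
        congr 1; ring
      rw [hRY']
      calc 512 * (4096 * π ^ 2 / 3 * (2 : ℝ) ^ q.primeFactors.card * (1 + ‖κ‖) * ((⌊W⌋₊ : ℝ) * ⌊W⌋₊) *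
            Real.exp (L / 2000 - 3 * L / 400))
          ≤ 512 * (4096 * π ^ 2 / 3 * (C_d * T₀) * (4 * T₀) * Real.exp (2 * L / 1000) *
            Real.exp (L / 2000 - 3 * L / 400)) := by gcongr
        _ = K_rem * C_d * (T₀ * T₀ * Real.exp (2 * L / 1000) * Real.exp (L / 2000 - 3 * L / 400)) := by
            rw [hK_rem]; ring
        _ = K_rem * C_d * Real.exp (-(3 / 1000) * L) := by
            rw [hT₀, ← Real.exp_add, ← Real.exp_add, ← Real.exp_add]; congr 2; ring
    have hrem2 : 2 * ((⌊W⌋₊ : ℝ) * ⌊W⌋₊ * ((1 + X) * Real.exp (-(N₁ : ℝ) / X))) ≤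
        4 * X ^ (26 / 25 : ℝ) * Real.exp (2 - X) := by
      have hN : Real.exp (-(N₁ : ℝ) / X) ≤ Real.exp (2 - X) := by
        have := exp_neg_floor_sq_div_le hX1
        rw [hN₁]; exact_mod_cast this
      have hVW : 2 * ((⌊W⌋₊ : ℝ) * ⌊W⌋₊ * (1 + X)) ≤ 4 * X ^ (26 / 25 : ℝ) := by
        have hWV : W ≤ V := Real.exp_le_exp.2 (by linarith)
        have h1 : (⌊W⌋₊ : ℝ) * ⌊W⌋₊ ≤ V * W :=
          mul_le_mul ((Nat.floor_le (by positivity)).trans hWV) (Nat.floor_le (by positivity))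
            (by positivity) (by positivity)
        have h2 : 1 + X ≤ 2 * X := by linarith
        have h3 : V * W * (2 * X) ≤ 2 * X ^ (26 / 25 : ℝ) := by
          rw [hV, hW, hX, ← Real.exp_mul]
          have : Real.exp (L / 20 + L / 1000 + 7 * L / 5) ≤ Real.exp (7 * L / 5 * (26 / 25)) :=
            Real.exp_le_exp.2 (by nlinarith)
          calc Real.exp (L / 20) * Real.exp (L / 1000) * (2 * Real.exp (7 * L / 5))
              = 2 * Real.exp (L / 20 + L / 1000 + 7 * L / 5) := by rw [Real.exp_add, Real.exp_add]; ring
            _ ≤ 2 * Real.exp (7 * L / 5 * (26 / 25)) := by linarith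
        nlinarith [mul_le_mul h1 h2 (by positivity) (by positivity)]
      calc 2 * ((⌊W⌋₊ : ℝ) * ⌊W⌋₊ * ((1 + X) * Real.exp (-(N₁ : ℝ) / X)))
          = 2 * ((⌊W⌋₊ : ℝ) * ⌊W⌋₊ * (1 + X)) * Real.exp (-(N₁ : ℝ) / X) := by ring
        _ ≤ 4 * X ^ (26 / 25 : ℝ) * Real.exp (2 - X) := mul_le_mul hVW hN (Real.exp_nonneg _) (by positivity)
    rw [hREMmax]
    exact add_le_add hrem1 hrem2
  -- the row sums of the kernel
  set S : ℝ := 1 + Real.log (X / Y) / L + L / Real.log R with hS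
  have hSval : S ≤ 1003 := by
    have h1 : Real.log (X / Y) = 137 / 100 * L := by rw [hX, hY, ← Real.exp_sub, Real.log_exp]; ring
    rw [hS, h1, hlogR]
    have : 137 / 100 * L / L = 137 / 100 := by field_simp
    have : L / (L / 1000) = 1000 := by field_simp
    linarith
  have hXlam : X ^ (2 * lam / L) = Real.exp (14 / 5 * lam) := by
    rw [hX, Real.rpow_def_of_pos (Real.exp_pos _), Real.log_exp]; congr 1; field_simp; ring
  set MAIN : ℝ := C_A * C_R * 1003 * Real.exp (14 / 5 * lam) * (1 + lam) with hMAIN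
  have hMAIN0 : 0 ≤ MAIN := by rw [hMAIN]; positivity
  have hrowsum : ∀ i ∈ Z, A_D * ∑ j ∈ Z, kernel X Y R J (2 - i - (starRingEnd ℂ) j) ≤ MAIN := by
    intro i hi
    have h := hrowK q χ hprim hq1 (by rw [← hLdef]; linarith) X Y R J hY1 hYX hR1 hJ0 hJR lam T₀ hlam
      (by rw [← hLdef]; linarith) (by linarith) (by rw [← hLdef]; exact hlogT₀) Z
      (fun ρ h => by rw [← hLdef]; exact hZ' ρ h) i hi
    rw [← hLdef, ← hS, hXlam] at h
    calc A_D * ∑ j ∈ Z, kernel X Y R J (2 - i - (starRingEnd ℂ) j)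
        ≤ (C_A / L) * (C_R * Real.exp (14 / 5 * lam) * L * (1 + lam) * S) :=
          mul_le_mul hA_DL h (sum_nonneg fun j _ => kernel_nonneg _ _ _ _ _) (by positivity)
      _ = C_A * C_R * S * Real.exp (14 / 5 * lam) * (1 + lam) := by field_simp
      _ ≤ MAIN := by
          rw [hMAIN]
          have : 0 ≤ C_A * C_R * Real.exp (14 / 5 * lam) * (1 + lam) := by positivity
          nlinarith
  set R₁ : ℝ := MAIN + (Z.card : ℝ) * REMmax with hR₁def
  have hR₁0 : 0 ≤ R₁ := by rw [hR₁def]; exact add_nonneg hMAIN0 (mul_nonneg (Nat.cast_nonneg _) hREMmax0)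
  have hrow : ∀ i ∈ Z, ∑ j ∈ Z, ‖∑ n ∈ Icc 1 N₁, aCoef χ W X Y R J i n * (starRingEnd ℂ) (aCoef χ W X Y R J j n)‖ ≤ R₁ := by
    intro i hi
    calc ∑ j ∈ Z, ‖∑ n ∈ Icc 1 N₁, aCoef χ W X Y R J i n * (starRingEnd ℂ) (aCoef χ W X Y R J j n)‖
        ≤ ∑ j ∈ Z, (A_D * kernel X Y R J (2 - i - (starRingEnd ℂ) j) + REMmax) :=
          sum_le_sum fun j hj => hpair i hi j hj
      _ = A_D * ∑ j ∈ Z, kernel X Y R J (2 - i - (starRingEnd ℂ) j) + (Z.card : ℝ) * REMmax := by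
          rw [sum_add_distrib, mul_sum, sum_const, nsmul_eq_mul]
      _ ≤ R₁ := by rw [hR₁def]; exact add_le_add (hrowsum i hi) le_rfl
  have hcol : ∀ j ∈ Z, ∑ i ∈ Z, ‖∑ n ∈ Icc 1 N₁, aCoef χ W X Y R J i n * (starRingEnd ℂ) (aCoef χ W X Y R J j n)‖ ≤ R₁ := by
    intro j hj
    calc ∑ i ∈ Z, ‖∑ n ∈ Icc 1 N₁, aCoef χ W X Y R J i n * (starRingEnd ℂ) (aCoef χ W X Y R J j n)‖
        ≤ ∑ i ∈ Z, (A_D * kernel X Y R J (2 - i - (starRingEnd ℂ) j) + REMmax) :=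
          sum_le_sum fun i hi => hpair i hi j hj
      _ = A_D * ∑ i ∈ Z, kernel X Y R J (2 - j - (starRingEnd ℂ) i) + (Z.card : ℝ) * REMmax := by
          rw [sum_add_distrib, mul_sum, sum_const, nsmul_eq_mul]
          congr 1
          refine sum_congr rfl fun i _ => ?_
          rw [two_sub_sub_conj i j, kernel_conj X Y R hX0.le hY0.le hR0.le]
      _ ≤ R₁ := by rw [hR₁def]; exact add_le_add (hrowsum j hj) le_rfl
  /- ── Step 5: duality and conclusion ── -/
  have hdual := sum_weights_le_of_duality Z (Icc 1 N₁) (aCoef χ W X Y R J) (bCoef U V X Y R J)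
    (fun i => (zeroOrder χ i : ℝ)) hB₀0.le hR₁0 hM0 hm hdet hb hrow hcol
  set N : ℝ := ∑ i ∈ Z, (zeroOrder χ i : ℝ) with hNdef
  have hcardN : (Z.card : ℝ) ≤ N := by
    rw [hNdef, card_eq_sum_ones]; push_cast
    refine sum_le_sum fun i hi => ?_
    have := (zeroOrder_pos_iff χ hχ i).2 (hZ' i hi).1
    exact_mod_cast this
  -- (S5): `4 B₀ M REMmax ≤ 1/2`
  have hML : M ≤ C_loc * L := by
    rw [hM]; refine mul_le_mul_of_nonneg_left ?_ hC_loc.le; linarith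
  have hS5 : 4 * B₀ * M * REMmax ≤ 1 / 2 := by
    have h1 : 4 * B₀ * (C_loc * L) * (K_rem * C_d * Real.exp (-(3 / 1000) * L)) ≤ 1 / 4 := by
      have hev := hL₅ L hLL₅
      rw [pow_one] at hev
      have hexp : Real.exp (-(3 / 1000) * L) = (Real.exp (3 / 1000 * L))⁻¹ := by
        rw [← Real.exp_neg]; congr 1; ring
      rw [hexp]
      have hpos : 0 < Real.exp (3 / 1000 * L) := Real.exp_pos _
      calc 4 * B₀ * (C_loc * L) * (K_rem * C_d * (Real.exp (3 / 1000 * L))⁻¹)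
          = (16 * B₀ * C_loc * K_rem * C_d * L) / Real.exp (3 / 1000 * L) / 4 := by field_simp; ring
        _ ≤ Real.exp (3 / 1000 * L) / Real.exp (3 / 1000 * L) / 4 := by gcongr
        _ = 1 / 4 := by field_simp
    have h2 : 4 * B₀ * (C_loc * L) * (4 * X ^ (26 / 25 : ℝ) * Real.exp (2 - X)) ≤ 1 / 4 := by
      have hLX : L ≤ X := by rw [hX]; have := Real.add_one_le_exp (7 * L / 5); linarith
      have hev := ht₃ X (hLt₃.trans hLX)
      have hXpow : L * X ^ (26 / 25 : ℝ) ≤ X ^ (51 / 25 : ℝ) := by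
        calc L * X ^ (26 / 25 : ℝ) ≤ X * X ^ (26 / 25 : ℝ) := mul_le_mul_of_nonneg_right hLX (by positivity)
          _ = X ^ (51 / 25 : ℝ) := by
              rw [← Real.rpow_one_add' hX0.le (by norm_num)]; norm_num
      calc 4 * B₀ * (C_loc * L) * (4 * X ^ (26 / 25 : ℝ) * Real.exp (2 - X))
          = 16 * B₀ * C_loc * Real.exp 2 * (L * X ^ (26 / 25 : ℝ)) * (Real.exp (1 * X))⁻¹ := by
            rw [Real.exp_sub, one_mul]; field_simp; ring
        _ ≤ 16 * B₀ * C_loc * Real.exp 2 * X ^ (51 / 25 : ℝ) * (Real.exp (1 * X))⁻¹ := by gcongr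
        _ = (64 * B₀ * C_loc * Real.exp 2 * X ^ (51 / 25 : ℝ)) / Real.exp (1 * X) / 4 := by field_simp; ring
        _ ≤ Real.exp (1 * X) / Real.exp (1 * X) / 4 := by gcongr
        _ = 1 / 4 := by field_simp
    have h3 : 4 * B₀ * M * REMmax ≤ 4 * B₀ * (C_loc * L) * REMmax := by gcongr
    rw [hREMmax] at h3 ⊢
    nlinarith [h1, h2, h3]
  -- `N ≤ 4 B₀ R₁ M = 4 B₀ M MAIN + (4 B₀ M REMmax) |Z| ≤ 4 B₀ M MAIN + N/2`
  have hN1 : N ≤ 4 * B₀ * M * MAIN + (1 / 2) * N := by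
    have h1 : N ≤ 4 * B₀ * R₁ * M := hdual
    rw [hR₁def] at h1
    have h2 : 4 * B₀ * (MAIN + (Z.card : ℝ) * REMmax) * M = 4 * B₀ * M * MAIN + (4 * B₀ * M * REMmax) * Z.card := by
      ring
    rw [h2] at h1
    have h3 : (4 * B₀ * M * REMmax) * (Z.card : ℝ) ≤ (1 / 2) * N :=
      mul_le_mul hS5 hcardN (Nat.cast_nonneg _) (by norm_num)
    linarith
  have hN2 : N ≤ 8 * B₀ * M * MAIN := by linarith
  -- the final shape
  calc N ≤ 8 * B₀ * M * MAIN := hN2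
    _ = 8 * 1003 * B₀ * C_loc * C_A * C_R * ((3 + 2 * lam) * (1 + lam)) * Real.exp (14 / 5 * lam) := by
        rw [hM, hMAIN]; ring
    _ ≤ 8 * 1003 * B₀ * C_loc * C_A * C_R * (3 * (100 * Real.exp (lam / 5))) * Real.exp (14 / 5 * lam) := by
        have hfin : (3 + 2 * lam) * (1 + lam) ≤ 3 * (100 * Real.exp (lam / 5)) :=
          calc (3 + 2 * lam) * (1 + lam) ≤ 3 * (1 + lam) ^ 2 := by nlinarith
            _ ≤ 3 * (100 * Real.exp (lam / 5)) := by
                have := one_add_sq_le_exp hlam; linarith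
        have h0 : 0 ≤ 8 * 1003 * B₀ * C_loc * C_A * C_R := by positivity
        exact mul_le_mul_of_nonneg_right (mul_le_mul_of_nonneg_left hfin h0) (Real.exp_nonneg _)
    _ = K * Real.exp (3 * lam) := by
        rw [hK, show (3 * lam : ℝ) = lam / 5 + 14 / 5 * lam by ring, Real.exp_add]; ring

end Literature.NumberTheory.LFunctions.LFDSingle
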